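import Mathlib
import Literature.Analysis.PDE.IsentropicEulerShockCurves
import HarnessLib

/-!
# Shock curves of the isentropic Euler system: Liu monotonicity, strengthening, entropy admissibility

Topic `Literature/Analysis/PDE`; companion PROOF file of `IsentropicEulerShockCurves.lean`
(Rankine–Hugoniot discontinuities, the explicit shock curves `S¹_U`, `S²_U` and speeds `σ¹_U`, `σ²_U`
of the isentropic Euler system with `P(ρ) = ρ^γ`, parameter `s` = density jump, after
[LegerVasseur2011, §6.1]; Rankine–Hugoniot, compressivity and the Lax inequalities are proved
there). This file proves **Assumption 1.1 (k)** of [ChenKrupaVasseur2022] for that system, the part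
of Lemma 4.5 delegated in print to Leger–Vasseur ((H1a,b), (H'1a,b) of [LegerVasseur2011, §2.2],
verified in §6.1), and then **(f)–(j)**: the entropic Rankine–Hugoniot discontinuities of the
`γ`-law are exactly the compressive ones, they verify the Lax inequalities, and the extremal ones
lie on the explicit curves:

* `hasDerivAt_speedRadicand`, `deriv_speedRadicand_pos` — for `φ(s) = ((ρ+s)/ρ)(P(ρ+s)-P(ρ))/s`,
  `φ′(s) = (s(ρ+s)P′(ρ+s) - ρ(P(ρ+s)-P(ρ)))/(ρs²) > 0` (`s > 0`; convexity of `P` and `P′ > 0` —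
  Leger–Vasseur: "the Liu condition holds if and only if `[ρP(ρ)]″ ≥ 0`");
* `hasDerivAt_oneShockSpeed`, `hasDerivAt_twoShockSpeed` — **Liu monotonicity**: `dσ¹_U/ds < 0`,
  `dσ²_U/ds > 0` ("`d/ds σ¹_{u_L}(s) < 0` and `d/ds σ²_{u_R}(s) > 0`", Assumption 1.1 (k));
* `relEntropy_isentropicEuler_eq` — Leger–Vasseur's formula
  `η(U|V) = η(U) - η(V) - ∇η(V)(U-V) = ρ/2 (u-u₀)² + S(ρ|ρ₀)`, `S(ρ) = ρ^γ/(γ-1)`;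
* `relEntropy_oneShockCurve_eq`, `relEntropy_twoShockCurve_eq` — its explicit value along the
  curves, `(P(ρ+s)-P(ρ))s/(2(ρ+s)) + S(ρ) - S(ρ+s) + sS′(ρ+s)`;
* `hasDerivAt_relEntropy_oneShock_explicit`, `deriv_relEntropy_oneShockCurve_pos`,
  `deriv_relEntropy_twoShockCurve_pos` — **"the shock strengthens with `s`"**:
  `d/ds η(U | S^{1,2}_U(s)) = (s(ρ+s)P′(ρ+s) + ρ(P(ρ+s)-P(ρ)))/(2(ρ+s)²) + sS″(ρ+s) > 0`
  (Leger–Vasseur's display; Assumption 1.1 (k): "`d/ds η(u_L | S¹_{u_L}(s)) > 0` … similarly for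
  `u_R`").

* `rankineHugoniot_isentropicEuler_relations` — Leger–Vasseur (6.1)–(6.2) for an ARBITRARY
  Rankine–Hugoniot discontinuity of isentropic Euler (division-free), and triviality when
  `ρ_L = ρ_R` (`rankineHugoniot_isentropicEuler_eq_of_density_eq`);
* `entropyDissipation_eq_of_rankineHugoniot`, `entropyDissipation_eq_massFlux_mul` — the entropy
  dissipation `q(U_R) - q(U_L) - σ(η(U_R) - η(U_L))` equals the mass flux `j = ρ_L(u_L - σ)` times
  the jump of the Bernoulli quantity `w²/2 + γ/(γ-1)ρ^{γ-1}` in the shock frame, `= j·G_{ρ_L}(ρ_R)`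
  with `G_c(r) = γ/(γ-1)(r^{γ-1} - c^{γ-1}) - (r^γ - c^γ)(1/r + 1/c)/2`; `bernoulliJump_sign`:
  `G_c < 0` right of `c`, `> 0` left of `c` (`G_c′ < 0` off `c` by the tangent inequality of the
  convex `P` — the Hermite–Hadamard sign for the convex `τ(P) = P^{-1/γ}` in primitive form);
* `entropicRankineHugoniot_compressive` — hence **entropic Rankine–Hugoniot discontinuities of the
  `γ`-law are compressive** (`j > 0, ρ_L < ρ_R` or `j < 0, ρ_R < ρ_L`), Leger–Vasseur's standing
  assumption "entropy admissible shocks are characterized by `u_L > u_R`";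
* **Assumption 1.1 (g), (i)** off the curves: `entropicRankineHugoniot_lax_one`
  (`σ > λ₁(u_R)`), `entropicRankineHugoniot_lax_two` (`σ < λ₂(u_L)`);
* **Assumption 1.1 (h), (j)**: `entropicRankineHugoniot_mem_oneShockCurve` (entropic with
  `σ ≤ λ₁(u_L)` ⇒ `u_R = S¹_{u_L}(ρ_R-ρ_L)`, `σ = σ¹_{u_L}(ρ_R-ρ_L)`),
  `entropicRankineHugoniot_mem_twoShockCurve` (entropic with `σ ≥ λ₂(u_R)` ⇒ on `S²_{u_R}`);
* **Assumption 1.1 (f)**: the curves consist of entropic shocks,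
  `isEntropicRankineHugoniot_oneShockCurve`, `isEntropicRankineHugoniot_twoShockCurve`.

* `tendsto_oneShockSpeed`, `tendsto_twoShockSpeed` — `σ^{1,2}_U(0+) = λ_{1,2}(U)` (Leger–Vasseur
  (H1a), (H'1a): "`σ_U(0) = λ^∓(U)`").

Deliberately NOT here: the `C¹`/Lipschitz regularity of
`(s,U) ↦ S_U(s), σ_U(s)` and of the exit parameter `s_U`, and the reparametrisation by
`s = |u_L - S¹_{u_L}(s)|` of [ChenKrupaVasseur2022, Assumption 1.1 (f)] (here `s` is the density
jump; in the sup norm `|u_L - S¹_{u_L}(s)| ≥ s`).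

## References

* N. Leger, A. Vasseur, Arch. Ration. Mech. Anal. 201 (2011) 271–302; arXiv:1008.3113, §2.2
  (H1), (H'1), §6.1 [LegerVasseur2011].
* G. Chen, S. G. Krupa, A. F. Vasseur, Arch. Ration. Mech. Anal. 246 (2022) 299–332;
  arXiv:2010.04761, Assumption 1.1 (k), Lemma 4.5 [ChenKrupaVasseur2022].
-/

noncomputable section

open Set

namespace Literature.Analysis.PDE

variable {γ : ℝ}

/-! ### Liu monotonicity: the 1-shock speed decreases, the 2-shock speed increases with `s` -/

/-- The function `φ(s) = ((ρ+s)/ρ)(P(ρ+s) - P(ρ))/s` under the square root of the shock speeds has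
the derivative `φ′(s) = (s(ρ+s)P′(ρ+s) - ρ(P(ρ+s)-P(ρ)))/(ρ s²)` for `s ≠ 0`, `ρ ≠ 0`, `ρ + s ≠ 0`.
[cite: LegerVasseur2011, §6.1 (formula for φ′)] -/
theorem hasDerivAt_speedRadicand (γ : ℝ) {ρ s : ℝ} (hρ : ρ ≠ 0) (hs : s ≠ 0) (hρs : ρ + s ≠ 0) :
    HasDerivAt (fun s : ℝ => (ρ + s) / ρ * (((ρ + s) ^ γ - ρ ^ γ) / s))
      ((s * (ρ + s) * (γ * (ρ + s) ^ (γ - 1)) - ρ * ((ρ + s) ^ γ - ρ ^ γ)) / (ρ * s ^ 2)) s := by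
  have hlin : HasDerivAt (fun s : ℝ => ρ + s) 1 s := (hasDerivAt_id s).const_add ρ
  have h1 : HasDerivAt (fun s : ℝ => (ρ + s) / ρ) (1 / ρ) s := hlin.div_const ρ
  have hP : HasDerivAt (fun s : ℝ => (ρ + s) ^ γ - ρ ^ γ) (1 * γ * (ρ + s) ^ (γ - 1)) s :=
    (hlin.rpow_const (p := γ) (Or.inl hρs)).sub_const _
  have h2 := hP.fun_div (hasDerivAt_id s) hs
  have h := h1.fun_mul h2
  refine h.congr_deriv ?_
  simp only [id, one_mul, mul_one]
  field_simp
  ring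

/-- `φ′(s) > 0` for `s > 0` (`ρ > 0`, `γ ≥ 1`): `ρ(P(ρ+s)-P(ρ)) ≤ ρ s P′(ρ+s) < s(ρ+s)P′(ρ+s)`
(convexity of `P` and `P′ > 0`; Leger–Vasseur: "the Liu condition holds if and only if
`[ρP(ρ)]″ ≥ 0`", here `[ρ^{γ+1}]″ > 0`). [cite: LegerVasseur2011, §6.1] -/
theorem deriv_speedRadicand_pos (hγ : 1 ≤ γ) {ρ s : ℝ} (hρ : 0 < ρ) (hs : 0 < s) :
    0 < (s * (ρ + s) * (γ * (ρ + s) ^ (γ - 1)) - ρ * ((ρ + s) ^ γ - ρ ^ γ)) / (ρ * s ^ 2) := by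
  have hγ0 : 0 < γ := by linarith
  have hρs : 0 < ρ + s := by linarith
  have hslope := pressureSlope_le_deriv hγ hρ hs
  have hP' : 0 < γ * (ρ + s) ^ (γ - 1) := mul_pos hγ0 (Real.rpow_pos_of_pos hρs _)
  have hnum : 0 < s * (ρ + s) * (γ * (ρ + s) ^ (γ - 1)) - ρ * ((ρ + s) ^ γ - ρ ^ γ) := by
    have h1 : (ρ + s) ^ γ - ρ ^ γ ≤ s * (γ * (ρ + s) ^ (γ - 1)) := by
      rwa [div_le_iff₀ hs, mul_comm] at hslope
    have h2 := mul_le_mul_of_nonneg_left h1 hρ.le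
    have h3 : 0 < s ^ 2 * (γ * (ρ + s) ^ (γ - 1)) := by positivity
    have e : s * (ρ + s) * (γ * (ρ + s) ^ (γ - 1)) - ρ * ((ρ + s) ^ γ - ρ ^ γ)
        = (ρ * (s * (γ * (ρ + s) ^ (γ - 1))) - ρ * ((ρ + s) ^ γ - ρ ^ γ))
          + s ^ 2 * (γ * (ρ + s) ^ (γ - 1)) := by ring
    rw [e]
    linarith
  positivity

/-- **Liu condition for the 1-shock curve** (Chen–Krupa–Vasseur Assumption 1.1 (k), second part;
Leger–Vasseur (H1a)): the 1-shock speed is strictly decreasing, `dσ¹_U/ds < 0` for `s > 0`.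
[cite: LegerVasseur2011, §6.1] -/
theorem hasDerivAt_oneShockSpeed (hγ : 1 ≤ γ) {U : Fin 2 → ℝ} (hρ : 0 < U 0) {s : ℝ} (hs : 0 < s) :
    HasDerivAt (oneShockSpeed γ U)
      (-(((s * (U 0 + s) * (γ * (U 0 + s) ^ (γ - 1)) - U 0 * ((U 0 + s) ^ γ - (U 0) ^ γ))
          / (U 0 * s ^ 2)) / (2 * Real.sqrt ((U 0 + s) / U 0 * (((U 0 + s) ^ γ - (U 0) ^ γ) / s)))))
      s ∧
    deriv (oneShockSpeed γ U) s < 0 := by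
  have hγ0 : 0 < γ := by linarith
  have hρs : 0 < U 0 + s := by linarith
  have hrad := speedRadicand_pos hγ0 hρ hs
  have hφ := hasDerivAt_speedRadicand γ hρ.ne' hs.ne' hρs.ne'
  have hsqrt := hφ.sqrt hrad.ne'
  have h : HasDerivAt (oneShockSpeed γ U) _ s := (hsqrt.const_sub (U 1 / U 0))
  refine ⟨h, ?_⟩
  rw [h.deriv]
  have hpos := deriv_speedRadicand_pos hγ hρ hs
  have hsq : 0 < Real.sqrt ((U 0 + s) / U 0 * (((U 0 + s) ^ γ - (U 0) ^ γ) / s)) :=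
    Real.sqrt_pos.2 hrad
  have : 0 < ((s * (U 0 + s) * (γ * (U 0 + s) ^ (γ - 1)) - U 0 * ((U 0 + s) ^ γ - (U 0) ^ γ))
      / (U 0 * s ^ 2)) / (2 * Real.sqrt ((U 0 + s) / U 0 * (((U 0 + s) ^ γ - (U 0) ^ γ) / s))) :=
    div_pos hpos (by positivity)
  linarith

/-- **Liu condition for the 2-shock curve** (Assumption 1.1 (k), second part; Leger–Vasseur
(H'1a)): the 2-shock speed is strictly increasing, `dσ²_U/ds > 0` for `s > 0`.
[cite: LegerVasseur2011, §6.1] -/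
theorem hasDerivAt_twoShockSpeed (hγ : 1 ≤ γ) {U : Fin 2 → ℝ} (hρ : 0 < U 0) {s : ℝ} (hs : 0 < s) :
    HasDerivAt (twoShockSpeed γ U)
      (((s * (U 0 + s) * (γ * (U 0 + s) ^ (γ - 1)) - U 0 * ((U 0 + s) ^ γ - (U 0) ^ γ))
          / (U 0 * s ^ 2)) / (2 * Real.sqrt ((U 0 + s) / U 0 * (((U 0 + s) ^ γ - (U 0) ^ γ) / s))))
      s ∧
    0 < deriv (twoShockSpeed γ U) s := by
  have hγ0 : 0 < γ := by linarith
  have hρs : 0 < U 0 + s := by linarith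
  have hrad := speedRadicand_pos hγ0 hρ hs
  have hφ := hasDerivAt_speedRadicand γ hρ.ne' hs.ne' hρs.ne'
  have hsqrt := hφ.sqrt hrad.ne'
  have h : HasDerivAt (twoShockSpeed γ U) _ s := (hsqrt.const_add (U 1 / U 0))
  refine ⟨h, ?_⟩
  rw [h.deriv]
  exact div_pos (deriv_speedRadicand_pos hγ hρ hs) (by positivity)

/-! ### The relative entropy `η(U|V) = ρ/2 (u - u₀)² + S(ρ|ρ₀)` and the strengthening of shocks -/

/-- **Leger–Vasseur's formula for the relative entropy of isentropic Euler**: for `U = (ρ, ρu)`,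
`V = (ρ₀, ρ₀u₀)` with `ρ₀ ≠ 0` (`ρ` arbitrary), writing `u = m/ρ`, `u₀ = m₀/ρ₀`,
`η(U|V) = η(U) - η(V) - ∇η(V)(U - V) = ρ/2 (u - u₀)² + S(ρ|ρ₀)` with `S(ρ) = ρ^γ/(γ-1)`,
`S(ρ|ρ₀) = S(ρ) - S(ρ₀) - S′(ρ₀)(ρ - ρ₀)` (here for `ρ ≠ 0` so that `m = ρ·(m/ρ)`).
[cite: LegerVasseur2011, §6.1] -/
theorem relEntropy_isentropicEuler_eq (γ : ℝ) {U V : Fin 2 → ℝ} (hρ : U 0 ≠ 0) (hρ₀ : V 0 ≠ 0) :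
    isentropicEulerEntropy γ U - isentropicEulerEntropy γ V
        - fderiv ℝ (isentropicEulerEntropy γ) V (U - V)
      = U 0 / 2 * (U 1 / U 0 - V 1 / V 0) ^ 2
        + ((U 0) ^ γ / (γ - 1) - (V 0) ^ γ / (γ - 1)
          - γ / (γ - 1) * (V 0) ^ (γ - 1) * (U 0 - V 0)) := by
  rw [(hasFDerivAt_isentropicEulerEntropy γ hρ₀).fderiv]
  simp [isentropicEulerEntropy]
  field_simp
  ring

/-- The relative entropy of the left state with respect to the moving right state of the 1-shock,
explicitly: `η(U|S¹_U(s)) = (P(ρ+s)-P(ρ)) s/(2(ρ+s)) + S(ρ) - S(ρ+s) + s S′(ρ+s)` for `s > 0`.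
[cite: LegerVasseur2011, §6.1] -/
theorem relEntropy_oneShockCurve_eq (hγ : 0 < γ) {U : Fin 2 → ℝ} (hρ : 0 < U 0) {s : ℝ}
    (hs : 0 < s) :
    isentropicEulerEntropy γ U - isentropicEulerEntropy γ (oneShockCurve γ U s)
        - fderiv ℝ (isentropicEulerEntropy γ) (oneShockCurve γ U s) (U - oneShockCurve γ U s)
      = ((U 0 + s) ^ γ - (U 0) ^ γ) * s / (2 * (U 0 + s))
        + ((U 0) ^ γ / (γ - 1) - (U 0 + s) ^ γ / (γ - 1)
          + γ / (γ - 1) * (U 0 + s) ^ (γ - 1) * s) := by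
  have hρs : 0 < U 0 + s := by linarith
  have hρs' : oneShockCurve γ U s 0 ≠ 0 := by simp; exact hρs.ne'
  rw [relEntropy_isentropicEuler_eq γ hρ.ne' hρs', oneShockCurve_one_apply, oneShockCurve_zero_apply,
    mul_div_cancel_left₀ _ hρs.ne']
  have hA2 : (U 1 / U 0 - (U 1 / U 0
      - Real.sqrt (((U 0 + s) ^ γ - U 0 ^ γ) * s / (U 0 * (U 0 + s))))) ^ 2
      = ((U 0 + s) ^ γ - U 0 ^ γ) * s / (U 0 * (U 0 + s)) := by
    rw [sub_sub_cancel, Real.sq_sqrt (velJumpRadicand_pos hγ hρ hs).le]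
  rw [hA2]
  field_simp
  ring

/-- Derivative of the explicit relative entropy along the 1-shock curve:
`d/ds [...] = (s(ρ+s)P′(ρ+s) + ρ(P(ρ+s)-P(ρ)))/(2(ρ+s)²) + s S″(ρ+s)` (Leger–Vasseur's display,
with `S″(r) = γ r^{γ-2}` written `γ r^{γ-1}/r`). [cite: LegerVasseur2011, §6.1] -/
theorem hasDerivAt_relEntropy_oneShock_explicit {γ : ℝ} (hγ : γ ≠ 1) {ρ s : ℝ} (hρs : ρ + s ≠ 0) :
    HasDerivAt (fun s : ℝ => ((ρ + s) ^ γ - ρ ^ γ) * s / (2 * (ρ + s))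
        + (ρ ^ γ / (γ - 1) - (ρ + s) ^ γ / (γ - 1) + γ / (γ - 1) * (ρ + s) ^ (γ - 1) * s))
      ((s * (ρ + s) * (γ * (ρ + s) ^ (γ - 1)) + ρ * ((ρ + s) ^ γ - ρ ^ γ)) / (2 * (ρ + s) ^ 2)
        + s * (γ * ((ρ + s) ^ (γ - 1) / (ρ + s)))) s := by
  have hγ' : γ - 1 ≠ 0 := sub_ne_zero.2 hγ
  have hlin : HasDerivAt (fun s : ℝ => ρ + s) 1 s := (hasDerivAt_id s).const_add ρ
  have hP : HasDerivAt (fun s : ℝ => (ρ + s) ^ γ - ρ ^ γ) (1 * γ * (ρ + s) ^ (γ - 1)) s :=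
    (hlin.rpow_const (p := γ) (Or.inl hρs)).sub_const _
  have hPγ : HasDerivAt (fun s : ℝ => (ρ + s) ^ γ) (1 * γ * (ρ + s) ^ (γ - 1)) s :=
    hlin.rpow_const (p := γ) (Or.inl hρs)
  have hPγ1 : HasDerivAt (fun s : ℝ => (ρ + s) ^ (γ - 1)) (1 * (γ - 1) * (ρ + s) ^ (γ - 1 - 1)) s :=
    hlin.rpow_const (p := γ - 1) (Or.inl hρs)
  have h1 := ((hP.fun_mul (hasDerivAt_id s)).fun_div (hlin.const_mul 2) (by simpa using hρs))
  have h2 := ((hPγ.div_const (γ - 1)).const_sub (ρ ^ γ / (γ - 1))).fun_add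
    (((hPγ1.const_mul (γ / (γ - 1))).fun_mul (hasDerivAt_id s)))
  have h := h1.fun_add h2
  refine h.congr_deriv ?_
  simp only [id, one_mul, mul_one]
  rw [Real.rpow_sub_one hρs (γ - 1)]
  field_simp
  ring

/-- **"The shock strengthens with `s`"** (Chen–Krupa–Vasseur Assumption 1.1 (k), first part;
Leger–Vasseur (H1b)): `d/ds η(U | S¹_U(s)) > 0` for `s > 0` (`γ > 1`): the derivative of the
explicit form is `(s(ρ+s)P′(ρ+s) + ρ(P(ρ+s)-P(ρ)))/(2(ρ+s)²) + s S″(ρ+s) > 0`, and the relative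
entropy along the curve agrees with the explicit form for `s > 0`.
[cite: LegerVasseur2011, §6.1] -/
theorem deriv_relEntropy_oneShockCurve_pos (hγ : 1 < γ) {U : Fin 2 → ℝ} (hρ : 0 < U 0) {s : ℝ}
    (hs : 0 < s) :
    0 < deriv (fun s : ℝ => isentropicEulerEntropy γ U - isentropicEulerEntropy γ (oneShockCurve γ U s)
        - fderiv ℝ (isentropicEulerEntropy γ) (oneShockCurve γ U s) (U - oneShockCurve γ U s)) s := by
  have hγ0 : 0 < γ := by linarith
  have hγne : γ ≠ 1 := by intro h; linarith
  have hρs : 0 < U 0 + s := by linarith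
  have hP := pressureJump_pos hγ0 hρ hs
  -- the relative entropy agrees with the explicit form near `s`
  have hev : (fun s : ℝ => isentropicEulerEntropy γ U - isentropicEulerEntropy γ (oneShockCurve γ U s)
        - fderiv ℝ (isentropicEulerEntropy γ) (oneShockCurve γ U s) (U - oneShockCurve γ U s))
      =ᶠ[nhds s] (fun s : ℝ => ((U 0 + s) ^ γ - (U 0) ^ γ) * s / (2 * (U 0 + s))
        + ((U 0) ^ γ / (γ - 1) - (U 0 + s) ^ γ / (γ - 1)
          + γ / (γ - 1) * (U 0 + s) ^ (γ - 1) * s)) := by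
    filter_upwards [Ioi_mem_nhds hs] with t ht
    exact relEntropy_oneShockCurve_eq hγ0 hρ ht
  have hd := hasDerivAt_relEntropy_oneShock_explicit (ρ := U 0) hγne hρs.ne'
  rw [hev.deriv_eq, hd.deriv]
  have hP' : 0 < γ * (U 0 + s) ^ (γ - 1) := mul_pos hγ0 (Real.rpow_pos_of_pos hρs _)
  have t1 : 0 < (s * (U 0 + s) * (γ * (U 0 + s) ^ (γ - 1)) + U 0 * ((U 0 + s) ^ γ - (U 0) ^ γ))
      / (2 * (U 0 + s) ^ 2) := by positivity
  have t2 : 0 < s * (γ * ((U 0 + s) ^ (γ - 1) / (U 0 + s))) := by positivity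
  linarith

/-- The same explicit form for the 2-shock: `η(U|S²_U(s))` (right state `U`, moving left state)
equals `(P(ρ+s)-P(ρ)) s/(2(ρ+s)) + S(ρ) - S(ρ+s) + s S′(ρ+s)` for `s > 0`.
[cite: LegerVasseur2011, §6.1] -/
theorem relEntropy_twoShockCurve_eq (hγ : 0 < γ) {U : Fin 2 → ℝ} (hρ : 0 < U 0) {s : ℝ}
    (hs : 0 < s) :
    isentropicEulerEntropy γ U - isentropicEulerEntropy γ (twoShockCurve γ U s)
        - fderiv ℝ (isentropicEulerEntropy γ) (twoShockCurve γ U s) (U - twoShockCurve γ U s)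
      = ((U 0 + s) ^ γ - (U 0) ^ γ) * s / (2 * (U 0 + s))
        + ((U 0) ^ γ / (γ - 1) - (U 0 + s) ^ γ / (γ - 1)
          + γ / (γ - 1) * (U 0 + s) ^ (γ - 1) * s) := by
  have hρs : 0 < U 0 + s := by linarith
  have hρs' : twoShockCurve γ U s 0 ≠ 0 := by simp; exact hρs.ne'
  rw [relEntropy_isentropicEuler_eq γ hρ.ne' hρs', twoShockCurve_one_apply, twoShockCurve_zero_apply,
    mul_div_cancel_left₀ _ hρs.ne']
  have hA2 : (U 1 / U 0 - (U 1 / U 0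
      + Real.sqrt (((U 0 + s) ^ γ - U 0 ^ γ) * s / (U 0 * (U 0 + s))))) ^ 2
      = ((U 0 + s) ^ γ - U 0 ^ γ) * s / (U 0 * (U 0 + s)) := by
    rw [show U 1 / U 0 - (U 1 / U 0
        + Real.sqrt (((U 0 + s) ^ γ - U 0 ^ γ) * s / (U 0 * (U 0 + s))))
        = -Real.sqrt (((U 0 + s) ^ γ - U 0 ^ γ) * s / (U 0 * (U 0 + s))) by ring, neg_sq,
      Real.sq_sqrt (velJumpRadicand_pos hγ hρ hs).le]
  rw [hA2]
  field_simp
  ring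

/-- **"The shock strengthens with `s`" for the 2-shock** (Assumption 1.1 (k): "Similarly, for
`u_R ∈ 𝒱`, and for all `s > 0`, `d/ds η(u_R | S²_{u_R}(s)) > 0`"; Leger–Vasseur (H'1b)), `γ > 1`.
[cite: LegerVasseur2011, §6.1] -/
theorem deriv_relEntropy_twoShockCurve_pos (hγ : 1 < γ) {U : Fin 2 → ℝ} (hρ : 0 < U 0) {s : ℝ}
    (hs : 0 < s) :
    0 < deriv (fun s : ℝ => isentropicEulerEntropy γ U - isentropicEulerEntropy γ (twoShockCurve γ U s)
        - fderiv ℝ (isentropicEulerEntropy γ) (twoShockCurve γ U s) (U - twoShockCurve γ U s)) s := by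
  have hγ0 : 0 < γ := by linarith
  have hγne : γ ≠ 1 := by intro h; linarith
  have hρs : 0 < U 0 + s := by linarith
  have hP := pressureJump_pos hγ0 hρ hs
  have hev : (fun s : ℝ => isentropicEulerEntropy γ U - isentropicEulerEntropy γ (twoShockCurve γ U s)
        - fderiv ℝ (isentropicEulerEntropy γ) (twoShockCurve γ U s) (U - twoShockCurve γ U s))
      =ᶠ[nhds s] (fun s : ℝ => ((U 0 + s) ^ γ - (U 0) ^ γ) * s / (2 * (U 0 + s))
        + ((U 0) ^ γ / (γ - 1) - (U 0 + s) ^ γ / (γ - 1)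
          + γ / (γ - 1) * (U 0 + s) ^ (γ - 1) * s)) := by
    filter_upwards [Ioi_mem_nhds hs] with t ht
    exact relEntropy_twoShockCurve_eq hγ0 hρ ht
  have hd := hasDerivAt_relEntropy_oneShock_explicit (ρ := U 0) hγne hρs.ne'
  rw [hev.deriv_eq, hd.deriv]
  have hP' : 0 < γ * (U 0 + s) ^ (γ - 1) := mul_pos hγ0 (Real.rpow_pos_of_pos hρs _)
  have t1 : 0 < (s * (U 0 + s) * (γ * (U 0 + s) ^ (γ - 1)) + U 0 * ((U 0 + s) ^ γ - (U 0) ^ γ))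
      / (2 * (U 0 + s) ^ 2) := by positivity
  have t2 : 0 < s * (γ * ((U 0 + s) ^ (γ - 1) / (U 0 + s))) := by positivity
  linarith

/-! ### The Rankine–Hugoniot relations (6.1)–(6.2) for an arbitrary discontinuity -/

/-- **Leger–Vasseur (6.1)–(6.2)**: if `{σ, (ρ_L, ρ_Lu_L), (ρ_R, ρ_Ru_R)}` satisfies the
Rankine–Hugoniot condition for the isentropic Euler flux (`ρ_L, ρ_R > 0`), then, in division-free
form (`ΔP = P_R - P_L`, `a = ρ_R - ρ_L`):
`(u_L - u_R)² ρ_R ρ_L = ΔP·a`, `(σ - u_L)² ρ_L a = ρ_R ΔP`, `(σ - u_R)² ρ_R a = ρ_L ΔP`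
(printed: `(u_L-u_R)² = (P_R-P_L)(ρ_R-ρ_L)/(ρ_Rρ_L)`,
`σ = u_L ± √((ρ_R/ρ_L)(P_R-P_L)/(ρ_R-ρ_L)) = u_R ± √((ρ_L/ρ_R)(P_R-P_L)/(ρ_R-ρ_L))`), together
with the continuity of the mass flux in the shock frame, `ρ_L(u_L - σ) = ρ_R(u_R - σ)`.
[cite: LegerVasseur2011, §6.1 (6.1)–(6.2)] -/
theorem rankineHugoniot_isentropicEuler_relations {UL UR : Fin 2 → ℝ} {σ : ℝ}
    (h : IsRankineHugoniot (isentropicEulerFlux γ) UL UR σ) (hL : 0 < UL 0) (hR : 0 < UR 0) :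
    UL 0 * (UL 1 / UL 0 - σ) = UR 0 * (UR 1 / UR 0 - σ) ∧
    (UL 1 / UL 0 - UR 1 / UR 0) ^ 2 * (UR 0 * UL 0) = ((UR 0) ^ γ - (UL 0) ^ γ) * (UR 0 - UL 0) ∧
    (σ - UL 1 / UL 0) ^ 2 * (UL 0 * (UR 0 - UL 0)) = UR 0 * ((UR 0) ^ γ - (UL 0) ^ γ) ∧
    (σ - UR 1 / UR 0) ^ 2 * (UR 0 * (UR 0 - UL 0)) = UL 0 * ((UR 0) ^ γ - (UL 0) ^ γ) := by
  rw [isRankineHugoniot_iff] at h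
  have h0 := h 0
  have h1 := h 1
  simp only [isentropicEulerFlux, Fin.isValue, Matrix.cons_val_zero, Matrix.cons_val_one,
    Matrix.cons_val_fin_one] at h0 h1
  set uL := UL 1 / UL 0 with huL
  set uR := UR 1 / UR 0 with huR
  have eL : UL 1 = UL 0 * uL := by rw [huL]; field_simp
  have eR : UR 1 = UR 0 * uR := by rw [huR]; field_simp
  rw [eL, eR] at h0 h1
  have f0 : (UL 0 * uL) ^ 2 / UL 0 = UL 0 * uL ^ 2 := by field_simp
  have f1 : (UR 0 * uR) ^ 2 / UR 0 = UR 0 * uR ^ 2 := by field_simp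
  rw [f0, f1] at h1
  -- `h0 : ρ_R u_R - ρ_L u_L = σ (ρ_R - ρ_L)`, `h1 : ρ_R u_R² + P_R - (ρ_L u_L² + P_L) = σ (ρ_R u_R - ρ_L u_L)`
  have hj : UL 0 * (uL - σ) = UR 0 * (uR - σ) := by linear_combination (-1 : ℝ) * h0
  have hS : (uL - uR) ^ 2 * (UR 0 * UL 0) = ((UR 0) ^ γ - (UL 0) ^ γ) * (UR 0 - UL 0) := by
    linear_combination (UR 0 * uR - UL 0 * uL) * h0 - (UR 0 - UL 0) * h1
  have hKL : (uL - σ) * (UR 0 - UL 0) = UR 0 * (uL - uR) := by linear_combination h0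
  have hKR : (uR - σ) * (UR 0 - UL 0) = UL 0 * (uL - uR) := by linear_combination h0
  have hKL2 : ((uL - σ) * (UR 0 - UL 0)) ^ 2 = (UR 0 * (uL - uR)) ^ 2 := by rw [hKL]
  have hKR2 : ((uR - σ) * (UR 0 - UL 0)) ^ 2 = (UL 0 * (uL - uR)) ^ 2 := by rw [hKR]
  refine ⟨hj, hS, ?_, ?_⟩
  · by_cases ha : UR 0 - UL 0 = 0
    · have hP : (UR 0) ^ γ - (UL 0) ^ γ = 0 := by rw [sub_eq_zero.1 ha, sub_self]
      rw [ha, hP]; ring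
    apply mul_left_cancel₀ ha
    linear_combination UL 0 * hKL2 + UR 0 * hS
  · by_cases ha : UR 0 - UL 0 = 0
    · have hP : (UR 0) ^ γ - (UL 0) ^ γ = 0 := by rw [sub_eq_zero.1 ha, sub_self]
      rw [ha, hP]; ring
    apply mul_left_cancel₀ ha
    linear_combination UR 0 * hKR2 + UL 0 * hS

/-- A Rankine–Hugoniot discontinuity of isentropic Euler with equal densities is trivial:
`ρ_L = ρ_R > 0` forces `u_L = u_R` (from `(u_L-u_R)² ρ_Rρ_L = ΔP·(ρ_R-ρ_L) = 0`). [folklore] -/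
theorem rankineHugoniot_isentropicEuler_eq_of_density_eq {UL UR : Fin 2 → ℝ} {σ : ℝ}
    (h : IsRankineHugoniot (isentropicEulerFlux γ) UL UR σ) (hL : 0 < UL 0) (hR : 0 < UR 0)
    (hρ : UL 0 = UR 0) : UL = UR := by
  obtain ⟨-, hS, -, -⟩ := rankineHugoniot_isentropicEuler_relations h hL hR
  have hS0 : (UL 1 / UL 0 - UR 1 / UR 0) ^ 2 * (UR 0 * UL 0) = 0 := by
    rw [hS, hρ, sub_self, zero_mul]
  have hsq : (UL 1 / UL 0 - UR 1 / UR 0) ^ 2 = 0 :=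
    (mul_eq_zero.1 hS0).resolve_right (mul_pos hR hL).ne'
  have hu : UL 1 / UL 0 = UR 1 / UR 0 := sub_eq_zero.1 (pow_eq_zero_iff two_ne_zero |>.1 hsq)
  ext i
  fin_cases i
  · exact hρ
  · have e1 : UL 1 = UL 0 * (UL 1 / UL 0) := by field_simp
    have e2 : UR 1 = UR 0 * (UR 1 / UR 0) := by field_simp
    simp only [Fin.mk_one]
    rw [e1, e2, hu, hρ]

/-! ### Entropy dissipation across a Rankine–Hugoniot discontinuity -/

/-- **Jump of the pressure in the shock frame**: for a Rankine–Hugoniot discontinuity of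
isentropic Euler (`ρ_L, ρ_R > 0`) with mass flux `j = ρ_L(u_L - σ) = ρ_R(u_R - σ)`,
`P_R - P_L = -j ((u_R - σ) - (u_L - σ))`. [folklore] -/
theorem pressureJump_eq_of_rankineHugoniot {UL UR : Fin 2 → ℝ} {σ : ℝ}
    (h : IsRankineHugoniot (isentropicEulerFlux γ) UL UR σ) (hL : 0 < UL 0) (hR : 0 < UR 0) :
    (UR 0) ^ γ - (UL 0) ^ γ
      = -(UL 0 * (UL 1 / UL 0 - σ)) * ((UR 1 / UR 0 - σ) - (UL 1 / UL 0 - σ)) := by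
  rw [isRankineHugoniot_iff] at h
  have h0 := h 0
  have h1 := h 1
  simp only [isentropicEulerFlux, Fin.isValue, Matrix.cons_val_zero, Matrix.cons_val_one,
    Matrix.cons_val_fin_one] at h0 h1
  set uL := UL 1 / UL 0 with huL
  set uR := UR 1 / UR 0 with huR
  have eL : UL 1 = UL 0 * uL := by rw [huL]; field_simp
  have eR : UR 1 = UR 0 * uR := by rw [huR]; field_simp
  rw [eL, eR] at h0 h1
  have f0 : (UL 0 * uL) ^ 2 / UL 0 = UL 0 * uL ^ 2 := by field_simp
  have f1 : (UR 0 * uR) ^ 2 / UR 0 = UR 0 * uR ^ 2 := by field_simp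
  rw [f0, f1] at h1
  linear_combination h1 - uR * h0

/-- The entropy flux in the shock frame, side by side:
`q(U) - ση(U) = ρ (u-σ) u²/2 + γ/(γ-1) (u-σ) P + σ P` (`ρ ≠ 0`, `γ ≠ 1`). [folklore] -/
theorem entropyFlux_sub_mul_entropy_eq (hγ : γ ≠ 1) {U : Fin 2 → ℝ} (hρ : U 0 ≠ 0) (σ : ℝ) :
    isentropicEulerEntropyFlux γ U - σ * isentropicEulerEntropy γ U
      = U 0 * (U 1 / U 0 - σ) * (U 1 / U 0) ^ 2 / 2 + γ / (γ - 1) * (U 1 / U 0 - σ) * (U 0) ^ γ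
        + σ * (U 0) ^ γ := by
  have hγ' : γ - 1 ≠ 0 := sub_ne_zero.2 hγ
  simp only [isentropicEulerEntropyFlux, isentropicEulerEntropy]
  field_simp
  ring

/-- **Entropy dissipation of a Rankine–Hugoniot discontinuity of isentropic Euler** (mass flux
times the jump of the Bernoulli quantity in the shock frame): with `w = u - σ`,
`j = ρ_L w_L = ρ_R w_R`, for `γ ≠ 1`,
`q(U_R) - q(U_L) - σ(η(U_R) - η(U_L)) = j (w_R² - w_L²)/2 + γ/(γ-1) (w_R P_R - w_L P_L)`
(`= j [w²/2 + γ/(γ-1) ρ^{γ-1}]`, cf. Leger–Vasseur's formula for the entropy lost at a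
Rankine–Hugoniot discontinuity). [cite: LegerVasseur2011, §3, §6.1] -/
theorem entropyDissipation_eq_of_rankineHugoniot (hγ : γ ≠ 1) {UL UR : Fin 2 → ℝ} {σ : ℝ}
    (h : IsRankineHugoniot (isentropicEulerFlux γ) UL UR σ) (hL : 0 < UL 0) (hR : 0 < UR 0) :
    isentropicEulerEntropyFlux γ UR - isentropicEulerEntropyFlux γ UL
        - σ * (isentropicEulerEntropy γ UR - isentropicEulerEntropy γ UL)
      = UL 0 * (UL 1 / UL 0 - σ) * (((UR 1 / UR 0 - σ) ^ 2 - (UL 1 / UL 0 - σ) ^ 2) / 2)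
        + γ / (γ - 1) * ((UR 1 / UR 0 - σ) * (UR 0) ^ γ - (UL 1 / UL 0 - σ) * (UL 0) ^ γ) := by
  have hP := pressureJump_eq_of_rankineHugoniot h hL hR
  obtain ⟨hj, -, -, -⟩ := rankineHugoniot_isentropicEuler_relations h hL hR
  have hXR := entropyFlux_sub_mul_entropy_eq hγ hR.ne' σ
  have hXL := entropyFlux_sub_mul_entropy_eq hγ hL.ne' σ
  have e : isentropicEulerEntropyFlux γ UR - isentropicEulerEntropyFlux γ UL
        - σ * (isentropicEulerEntropy γ UR - isentropicEulerEntropy γ UL)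
      = (isentropicEulerEntropyFlux γ UR - σ * isentropicEulerEntropy γ UR)
        - (isentropicEulerEntropyFlux γ UL - σ * isentropicEulerEntropy γ UL) := by ring
  rw [e, hXR, hXL]
  linear_combination σ * hP - ((UR 1 / UR 0) ^ 2 / 2) * hj

/-- Along a Rankine–Hugoniot discontinuity with `ρ_L ≠ ρ_R` the jump of the kinetic part of the
Bernoulli quantity is `(w_R² - w_L²)/2 = -(P_R - P_L)(1/ρ_R + 1/ρ_L)/2` (from (6.1)).
[cite: LegerVasseur2011, §6.1 (6.1)] -/
theorem kineticJump_eq_of_rankineHugoniot {UL UR : Fin 2 → ℝ} {σ : ℝ}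
    (h : IsRankineHugoniot (isentropicEulerFlux γ) UL UR σ) (hL : 0 < UL 0) (hR : 0 < UR 0)
    (hne : UL 0 ≠ UR 0) :
    ((UR 1 / UR 0 - σ) ^ 2 - (UL 1 / UL 0 - σ) ^ 2) / 2
      = -((UR 0) ^ γ - (UL 0) ^ γ) * (1 / UR 0 + 1 / UL 0) / 2 := by
  obtain ⟨-, -, hwL, hwR⟩ := rankineHugoniot_isentropicEuler_relations h hL hR
  have ha : UR 0 - UL 0 ≠ 0 := sub_ne_zero.2 (Ne.symm hne)
  have hwL' : (UL 1 / UL 0 - σ) ^ 2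
      = UR 0 * ((UR 0) ^ γ - (UL 0) ^ γ) / (UL 0 * (UR 0 - UL 0)) := by
    rw [eq_div_iff (mul_ne_zero hL.ne' ha), ← hwL]; ring
  have hwR' : (UR 1 / UR 0 - σ) ^ 2
      = UL 0 * ((UR 0) ^ γ - (UL 0) ^ γ) / (UR 0 * (UR 0 - UL 0)) := by
    rw [eq_div_iff (mul_ne_zero hR.ne' ha), ← hwR]; ring
  rw [hwL', hwR']
  field_simp
  ring

/-- **The entropy dissipation is the mass flux times `G_{ρ_L}(ρ_R)`**: for a Rankine–Hugoniot
discontinuity of isentropic Euler with `ρ_L ≠ ρ_R` (`γ > 1`),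
`q(U_R) - q(U_L) - σ(η(U_R) - η(U_L)) = j · G_{ρ_L}(ρ_R)` with `j = ρ_L(u_L - σ)` and
`G_c(r) = γ/(γ-1)(r^{γ-1} - c^{γ-1}) - (r^γ - c^γ)(1/r + 1/c)/2` (the jump of the Bernoulli
quantity `w²/2 + γ/(γ-1) ρ^{γ-1}` in the shock frame, expressed through (6.1)).
[cite: LegerVasseur2011, §3, §6.1] -/
theorem entropyDissipation_eq_massFlux_mul (hγ : 1 < γ) {UL UR : Fin 2 → ℝ} {σ : ℝ}
    (h : IsRankineHugoniot (isentropicEulerFlux γ) UL UR σ) (hL : 0 < UL 0) (hR : 0 < UR 0)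
    (hne : UL 0 ≠ UR 0) :
    isentropicEulerEntropyFlux γ UR - isentropicEulerEntropyFlux γ UL
        - σ * (isentropicEulerEntropy γ UR - isentropicEulerEntropy γ UL)
      = UL 0 * (UL 1 / UL 0 - σ) *
        (γ / (γ - 1) * ((UR 0) ^ (γ - 1) - (UL 0) ^ (γ - 1))
          - ((UR 0) ^ γ - (UL 0) ^ γ) * (1 / UR 0 + 1 / UL 0) / 2) := by
  have hγne : γ ≠ 1 := by intro h'; linarith
  have hγ' : γ - 1 ≠ 0 := sub_ne_zero.2 hγne
  rw [entropyDissipation_eq_of_rankineHugoniot hγne h hL hR,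
    kineticJump_eq_of_rankineHugoniot h hL hR hne]
  obtain ⟨hj, -, -, -⟩ := rankineHugoniot_isentropicEuler_relations h hL hR
  have hwR : UR 1 / UR 0 - σ = UL 0 * (UL 1 / UL 0 - σ) / UR 0 := by
    rw [eq_div_iff hR.ne', hj]; ring
  have hPR : (UR 0) ^ γ = (UR 0) ^ (γ - 1) * UR 0 := by
    rw [Real.rpow_sub_one hR.ne']; field_simp
  have hPL : (UL 0) ^ γ = (UL 0) ^ (γ - 1) * UL 0 := by
    rw [Real.rpow_sub_one hL.ne']; field_simp
  set j := UL 0 * (UL 1 / UL 0 - σ) with hjdef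
  have hwL : UL 1 / UL 0 - σ = j / UL 0 := by rw [hjdef]; field_simp
  rw [hwR, hwL, hPR, hPL]
  field_simp
  ring

/-- The derivative of `G_c(r) = γ/(γ-1)(r^{γ-1} - c^{γ-1}) - (r^γ - c^γ)(1/r + 1/c)/2`:
`G_c′(r) = ((r^γ - c^γ) - γ r^γ (r - c)/c)/(2r²)` (`r ≠ 0`, `c ≠ 0`, `γ ≠ 1`). [folklore] -/
theorem hasDerivAt_bernoulliJump {γ : ℝ} (hγ : γ ≠ 1) {c r : ℝ} (hc : c ≠ 0) (hr : r ≠ 0) :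
    HasDerivAt (fun r : ℝ => γ / (γ - 1) * (r ^ (γ - 1) - c ^ (γ - 1))
        - (r ^ γ - c ^ γ) * (1 / r + 1 / c) / 2)
      (((r ^ γ - c ^ γ) - γ * r ^ γ * (r - c) / c) / (2 * r ^ 2)) r := by
  have hγ' : γ - 1 ≠ 0 := sub_ne_zero.2 hγ
  have h1 : HasDerivAt (fun r : ℝ => r ^ (γ - 1)) ((γ - 1) * r ^ (γ - 1 - 1)) r := by
    simpa using Real.hasDerivAt_rpow_const (p := γ - 1) (Or.inl hr)
  have h2 : HasDerivAt (fun r : ℝ => r ^ γ) (γ * r ^ (γ - 1)) r := by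
    simpa using Real.hasDerivAt_rpow_const (p := γ) (Or.inl hr)
  have h3 : HasDerivAt (fun r : ℝ => 1 / r + 1 / c) (-(r ^ 2)⁻¹) r := by
    simpa [one_div] using (hasDerivAt_inv hr).add_const (1 / c)
  have h := ((h1.sub_const (c ^ (γ - 1))).const_mul (γ / (γ - 1))).sub
    (((h2.sub_const (c ^ γ)).mul h3).div_const 2)
  refine h.congr_deriv ?_
  rw [Real.rpow_sub_one hr (γ - 1), Real.rpow_sub_one hr γ]
  field_simp
  ring

/-- `G_c′(r) < 0` for `r ≠ c` (`r, c > 0`, `γ > 1`): by the tangent inequality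
`P(c) - P(r) ≥ P′(r)(c - r)` of the convex `P`, `c · (numerator) ≤ -P′(r)(r - c)² < 0`.
[folklore] -/
theorem deriv_bernoulliJump_neg (hγ : 1 < γ) {c r : ℝ} (hc : 0 < c) (hr : 0 < r) (hrc : r ≠ c) :
    ((r ^ γ - c ^ γ) - γ * r ^ γ * (r - c) / c) / (2 * r ^ 2) < 0 := by
  have hγ1 : 1 ≤ γ := hγ.le
  set q := r ^ (γ - 1) with hq
  have hq0 : 0 < q := Real.rpow_pos_of_pos hr _
  have hP' : 0 < γ * q := mul_pos (by linarith) hq0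
  have hrγ : r ^ γ = q * r := by rw [hq, Real.rpow_sub_one hr.ne']; field_simp
  -- tangent inequality at `r`: `P(c) - P(r) ≥ P'(r) (c - r)`
  have hT : r ^ γ - c ^ γ ≤ γ * q * (r - c) := by
    rcases lt_or_gt_of_ne hrc with hlt | hgt
    · have := (convexOn_rpow hγ1).le_slope_of_hasDerivAt (Set.mem_Ici.2 hr.le)
        (Set.mem_Ici.2 hc.le) hlt (Real.hasDerivAt_rpow_const (p := γ) (Or.inl hr.ne'))
      rw [slope_def_field, le_div_iff₀ (by linarith)] at this
      simp only [← hq] at this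
      linarith
    · have := (convexOn_rpow hγ1).slope_le_of_hasDerivAt (Set.mem_Ici.2 hc.le)
        (Set.mem_Ici.2 hr.le) hgt (Real.hasDerivAt_rpow_const (p := γ) (Or.inl hr.ne'))
      rw [slope_def_field, div_le_iff₀ (by linarith)] at this
      simp only [← hq] at this
      linarith
  have hsq : 0 < (r - c) ^ 2 := by
    have : r - c ≠ 0 := sub_ne_zero.2 hrc
    positivity
  have hcN : c * ((r ^ γ - c ^ γ) - γ * r ^ γ * (r - c) / c)
      = c * (r ^ γ - c ^ γ) - γ * r ^ γ * (r - c) := by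
    field_simp
  have hneg : c * ((r ^ γ - c ^ γ) - γ * r ^ γ * (r - c) / c) < 0 := by
    rw [hcN, hrγ]
    have e : c * (γ * q * (r - c)) - γ * (q * r) * (r - c) = -(γ * q) * (r - c) ^ 2 := by ring
    have h1 := mul_le_mul_of_nonneg_left hT hc.le
    nlinarith [mul_pos hP' hsq]
  have hN : (r ^ γ - c ^ γ) - γ * r ^ γ * (r - c) / c < 0 := by
    by_contra hcon
    have := mul_nonneg hc.le (not_lt.1 hcon)
    linarith
  exact div_neg_of_neg_of_pos hN (by positivity)

/-- **Sign of `G`**: `G_c(r) < 0` for `c < r` and `G_c(r) > 0` for `r < c` (`r, c > 0`, `γ > 1`):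
`G_c(c) = 0` and `G_c` is strictly decreasing on both sides of `c`. This is the Hermite–Hadamard
sign `∫_{P_L}^{P_R} τ dP ≤ (τ_L + τ_R)(P_R - P_L)/2` for the convex `τ(P) = P^{-1/γ}`, in
primitive form. [folklore] -/
theorem bernoulliJump_sign (hγ : 1 < γ) {c r : ℝ} (hc : 0 < c) (hr : 0 < r) :
    (c < r → γ / (γ - 1) * (r ^ (γ - 1) - c ^ (γ - 1)) - (r ^ γ - c ^ γ) * (1 / r + 1 / c) / 2 < 0) ∧
    (r < c → 0 < γ / (γ - 1) * (r ^ (γ - 1) - c ^ (γ - 1)) - (r ^ γ - c ^ γ) * (1 / r + 1 / c) / 2) := by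
  have hγne : γ ≠ 1 := by intro h; linarith
  set G : ℝ → ℝ := fun r => γ / (γ - 1) * (r ^ (γ - 1) - c ^ (γ - 1))
    - (r ^ γ - c ^ γ) * (1 / r + 1 / c) / 2 with hG
  have hGc : G c = 0 := by simp [hG]
  have hGd : ∀ x : ℝ, 0 < x → HasDerivAt G
      (((x ^ γ - c ^ γ) - γ * x ^ γ * (x - c) / c) / (2 * x ^ 2)) x := fun x hx =>
    hasDerivAt_bernoulliJump hγne hc.ne' hx.ne'
  have hGcont : ∀ a b : ℝ, 0 < a → ContinuousOn G (Icc a b) := fun a b ha x hx =>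
    (hGd x (lt_of_lt_of_le ha hx.1)).continuousAt.continuousWithinAt
  have hGanti : ∀ a b : ℝ, 0 < a → (∀ x ∈ Ioo a b, x ≠ c) → StrictAntiOn G (Icc a b) := by
    intro a b ha hne
    refine strictAntiOn_of_deriv_neg (convex_Icc a b) (hGcont a b ha) fun x hx => ?_
    rw [interior_Icc] at hx
    rw [(hGd x (ha.trans hx.1)).deriv]
    exact deriv_bernoulliJump_neg hγ hc (ha.trans hx.1) (hne x hx)
  constructor
  · intro hcr
    have hanti := hGanti c r hc (fun x hx => ne_of_gt hx.1)
    have := hanti (left_mem_Icc.2 hcr.le) (right_mem_Icc.2 hcr.le) hcr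
    rw [hGc] at this
    simpa [hG] using this
  · intro hrc
    have hanti := hGanti r c hr (fun x hx => ne_of_lt hx.2)
    have := hanti (left_mem_Icc.2 hrc.le) (right_mem_Icc.2 hrc.le) hrc
    rw [hGc] at this
    simpa [hG] using this

/-! ### Entropic Rankine–Hugoniot discontinuities of the `γ`-law: compressive, Lax, on the curves -/

/-- **Entropic Rankine–Hugoniot discontinuities of isentropic Euler are compressive** (`γ > 1`):
for an entropic Rankine–Hugoniot discontinuity `(U_L, U_R, σ)` with `U_L ≠ U_R` (densities `> 0`),
either the mass flux `j = ρ_L(u_L - σ)` is positive and `ρ_L < ρ_R` (1-family), or `j < 0` and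
`ρ_R < ρ_L` (2-family) — Leger–Vasseur's standing assumption "the entropy admissible shocks are
characterized by the relation `u_L > u_R`", obtained here from the dissipation formula
`q(U_R) - q(U_L) - σ(η(U_R) - η(U_L)) = j G_{ρ_L}(ρ_R)` and the sign of `G`.
[cite: LegerVasseur2011, §6.1] -/
theorem entropicRankineHugoniot_compressive (hγ : 1 < γ) {UL UR : Fin 2 → ℝ} {σ : ℝ}
    (h : IsEntropicRankineHugoniot (isentropicEulerFlux γ) (isentropicEulerEntropy γ)
      (isentropicEulerEntropyFlux γ) UL UR σ)
    (hL : 0 < UL 0) (hR : 0 < UR 0) (hne : UL ≠ UR) :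
    (0 < UL 0 * (UL 1 / UL 0 - σ) ∧ UL 0 < UR 0) ∨
      (UL 0 * (UL 1 / UL 0 - σ) < 0 ∧ UR 0 < UL 0) := by
  obtain ⟨hRH, hent⟩ := h
  have hγ0 : 0 < γ := by linarith
  have hρne : UL 0 ≠ UR 0 := fun heq =>
    hne (rankineHugoniot_isentropicEuler_eq_of_density_eq hRH hL hR heq)
  have hD : isentropicEulerEntropyFlux γ UR - isentropicEulerEntropyFlux γ UL
      - σ * (isentropicEulerEntropy γ UR - isentropicEulerEntropy γ UL) ≤ 0 := by linarith
  rw [entropyDissipation_eq_massFlux_mul hγ hRH hL hR hρne] at hD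
  have hP := pressureJump_eq_of_rankineHugoniot hRH hL hR
  obtain ⟨hGneg, hGpos⟩ := bernoulliJump_sign hγ hL hR (c := UL 0) (r := UR 0)
  set j := UL 0 * (UL 1 / UL 0 - σ) with hj
  set G := γ / (γ - 1) * ((UR 0) ^ (γ - 1) - (UL 0) ^ (γ - 1))
    - ((UR 0) ^ γ - (UL 0) ^ γ) * (1 / UR 0 + 1 / UL 0) / 2 with hG
  rcases lt_or_gt_of_ne hρne with hlt | hgt
  · left
    have hG0 := hGneg hlt
    have hΔP : 0 < (UR 0) ^ γ - (UL 0) ^ γ := sub_pos.2 (Real.rpow_lt_rpow hL.le hlt hγ0)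
    have hj0 : j ≠ 0 := by
      intro h0; rw [h0] at hP; simp at hP; linarith
    refine ⟨?_, hlt⟩
    rcases lt_or_gt_of_ne hj0 with hjn | hjp
    · nlinarith
    · exact hjp
  · right
    have hG0 := hGpos hgt
    have hΔP : (UR 0) ^ γ - (UL 0) ^ γ < 0 := sub_neg.2 (Real.rpow_lt_rpow hR.le hgt hγ0)
    have hj0 : j ≠ 0 := by
      intro h0; rw [h0] at hP; simp at hP; linarith
    refine ⟨?_, hgt⟩
    rcases lt_or_gt_of_ne hj0 with hjn | hjp
    · exact hjn
    · nlinarith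

/-- In the 1-family (`ρ_L < ρ_R`) the relative velocity on the right is subsonic:
`(σ - u_R)² < γ ρ_R^{γ-1} = c_R²` (from (6.1): `(σ-u_R)² = (ρ_L/ρ_R)·ΔP/Δρ < ΔP/Δρ ≤ P′(ρ_R)`).
[cite: LegerVasseur2011, §6.1] -/
theorem sq_relVel_right_lt_of_rankineHugoniot (hγ : 1 < γ) {UL UR : Fin 2 → ℝ} {σ : ℝ}
    (h : IsRankineHugoniot (isentropicEulerFlux γ) UL UR σ) (hL : 0 < UL 0) (hR : 0 < UR 0)
    (hlt : UL 0 < UR 0) :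
    (σ - UR 1 / UR 0) ^ 2 < γ * (UR 0) ^ (γ - 1) := by
  have hγ0 : 0 < γ := by linarith
  obtain ⟨-, -, -, hwR⟩ := rankineHugoniot_isentropicEuler_relations h hL hR
  have hd : 0 < UR 0 - UL 0 := sub_pos.2 hlt
  have hslope := pressureSlope_le_deriv hγ.le hL hd
  have hs : UL 0 + (UR 0 - UL 0) = UR 0 := by ring
  rw [hs, div_le_iff₀ hd] at hslope
  have hP' : 0 < γ * (UR 0) ^ (γ - 1) := mul_pos hγ0 (Real.rpow_pos_of_pos hR _)
  have key : (σ - UR 1 / UR 0) ^ 2 * (UR 0 * (UR 0 - UL 0))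
      < γ * (UR 0) ^ (γ - 1) * (UR 0 * (UR 0 - UL 0)) := by
    rw [hwR]
    nlinarith [mul_le_mul_of_nonneg_left hslope hL.le, mul_pos hP' hd]
  exact lt_of_mul_lt_mul_right key (by positivity)

/-- In the 2-family (`ρ_R < ρ_L`) the relative velocity on the left is subsonic:
`(σ - u_L)² < γ ρ_L^{γ-1} = c_L²`. [cite: LegerVasseur2011, §6.1] -/
theorem sq_relVel_left_lt_of_rankineHugoniot (hγ : 1 < γ) {UL UR : Fin 2 → ℝ} {σ : ℝ}
    (h : IsRankineHugoniot (isentropicEulerFlux γ) UL UR σ) (hL : 0 < UL 0) (hR : 0 < UR 0)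
    (hgt : UR 0 < UL 0) :
    (σ - UL 1 / UL 0) ^ 2 < γ * (UL 0) ^ (γ - 1) := by
  have hγ0 : 0 < γ := by linarith
  obtain ⟨-, -, hwL, -⟩ := rankineHugoniot_isentropicEuler_relations h hL hR
  have hd : 0 < UL 0 - UR 0 := sub_pos.2 hgt
  have hslope := pressureSlope_le_deriv hγ.le hR hd
  have hs : UR 0 + (UL 0 - UR 0) = UL 0 := by ring
  rw [hs, div_le_iff₀ hd] at hslope
  have hP' : 0 < γ * (UL 0) ^ (γ - 1) := mul_pos hγ0 (Real.rpow_pos_of_pos hL _)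
  have hwL' : (σ - UL 1 / UL 0) ^ 2 * (UL 0 * (UL 0 - UR 0))
      = UR 0 * ((UL 0) ^ γ - (UR 0) ^ γ) := by linear_combination (-1 : ℝ) * hwL
  have key : (σ - UL 1 / UL 0) ^ 2 * (UL 0 * (UL 0 - UR 0))
      < γ * (UL 0) ^ (γ - 1) * (UL 0 * (UL 0 - UR 0)) := by
    rw [hwL']
    nlinarith [mul_le_mul_of_nonneg_left hslope hR.le, mul_pos hP' hd]
  exact lt_of_mul_lt_mul_right key (by positivity)

/-- **Chen–Krupa–Vasseur Assumption 1.1 (g) for isentropic Euler** (Leger–Vasseur (H2)): for an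
entropic Rankine–Hugoniot discontinuity with `U_L ≠ U_R` (`γ > 1`),
`σ > λ₁(U_R) = u_R - √γ ρ_R^{(γ-1)/2}`. [cite: LegerVasseur2011, §6.1 and §2.2 (H2)] -/
theorem entropicRankineHugoniot_lax_one (hγ : 1 < γ) {UL UR : Fin 2 → ℝ} {σ : ℝ}
    (h : IsEntropicRankineHugoniot (isentropicEulerFlux γ) (isentropicEulerEntropy γ)
      (isentropicEulerEntropyFlux γ) UL UR σ)
    (hL : 0 < UL 0) (hR : 0 < UR 0) (hne : UL ≠ UR) :
    UR 1 / UR 0 - Real.sqrt γ * (UR 0) ^ ((γ - 1) / 2) < σ := by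
  have hγ0 : 0 < γ := by linarith
  have hcR : 0 < Real.sqrt γ * (UR 0) ^ ((γ - 1) / 2) :=
    mul_pos (Real.sqrt_pos.2 hγ0) (Real.rpow_pos_of_pos hR _)
  obtain ⟨hj, -, -, -⟩ := rankineHugoniot_isentropicEuler_relations h.1 hL hR
  rcases entropicRankineHugoniot_compressive hγ h hL hR hne with ⟨hjp, hlt⟩ | ⟨hjn, hgt⟩
  · have hsq := sq_relVel_right_lt_of_rankineHugoniot hγ h.1 hL hR hlt
    rw [← sq_soundSpeed hγ0.le hR] at hsq
    have := (abs_lt_of_sq_lt_sq' hsq hcR.le).1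
    linarith
  · rw [hj] at hjn
    have hw0 : UR 1 / UR 0 - σ < 0 := by
      by_contra hc
      have := mul_nonneg hR.le (not_lt.1 hc)
      linarith
    linarith

/-- **Chen–Krupa–Vasseur Assumption 1.1 (i) for isentropic Euler** (Leger–Vasseur (H'2)): for an
entropic Rankine–Hugoniot discontinuity with `U_L ≠ U_R` (`γ > 1`),
`σ < λ₂(U_L) = u_L + √γ ρ_L^{(γ-1)/2}`. [cite: LegerVasseur2011, §6.1 and §2.2 (H'2)] -/
theorem entropicRankineHugoniot_lax_two (hγ : 1 < γ) {UL UR : Fin 2 → ℝ} {σ : ℝ}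
    (h : IsEntropicRankineHugoniot (isentropicEulerFlux γ) (isentropicEulerEntropy γ)
      (isentropicEulerEntropyFlux γ) UL UR σ)
    (hL : 0 < UL 0) (hR : 0 < UR 0) (hne : UL ≠ UR) :
    σ < UL 1 / UL 0 + Real.sqrt γ * (UL 0) ^ ((γ - 1) / 2) := by
  have hγ0 : 0 < γ := by linarith
  have hcL : 0 < Real.sqrt γ * (UL 0) ^ ((γ - 1) / 2) :=
    mul_pos (Real.sqrt_pos.2 hγ0) (Real.rpow_pos_of_pos hL _)
  rcases entropicRankineHugoniot_compressive hγ h hL hR hne with ⟨hjp, hlt⟩ | ⟨hjn, hgt⟩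
  · have hw0 : 0 < UL 1 / UL 0 - σ := by
      by_contra hc
      have := mul_nonpos_of_nonneg_of_nonpos hL.le (not_lt.1 hc)
      linarith
    linarith
  · have hsq := sq_relVel_left_lt_of_rankineHugoniot hγ h.1 hL hR hgt
    rw [← sq_soundSpeed hγ0.le hL] at hsq
    have := (abs_lt_of_sq_lt_sq' hsq hcL.le).2
    linarith

/-- **Chen–Krupa–Vasseur Assumption 1.1 (h) for isentropic Euler** (Leger–Vasseur (H3)): an
entropic Rankine–Hugoniot discontinuity with `σ ≤ λ₁(u_L)` is a 1-shock, i.e. lies on the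
1-shock curve through `u_L`: `u_R = S¹_{u_L}(s)` and `σ = σ¹_{u_L}(s)` with `s = ρ_R - ρ_L > 0`.
[cite: LegerVasseur2011, §6.1 and §2.2 (H3)] -/
theorem entropicRankineHugoniot_mem_oneShockCurve (hγ : 1 < γ) {UL UR : Fin 2 → ℝ} {σ : ℝ}
    (h : IsEntropicRankineHugoniot (isentropicEulerFlux γ) (isentropicEulerEntropy γ)
      (isentropicEulerEntropyFlux γ) UL UR σ)
    (hL : 0 < UL 0) (hR : 0 < UR 0) (hne : UL ≠ UR)
    (hσ : σ ≤ UL 1 / UL 0 - Real.sqrt γ * (UL 0) ^ ((γ - 1) / 2)) :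
    UL 0 < UR 0 ∧ UR = oneShockCurve γ UL (UR 0 - UL 0) ∧
      σ = oneShockSpeed γ UL (UR 0 - UL 0) := by
  have hγ0 : 0 < γ := by linarith
  have hcL : 0 < Real.sqrt γ * (UL 0) ^ ((γ - 1) / 2) :=
    mul_pos (Real.sqrt_pos.2 hγ0) (Real.rpow_pos_of_pos hL _)
  obtain ⟨hj, hS, hwL, -⟩ := rankineHugoniot_isentropicEuler_relations h.1 hL hR
  -- the mass flux is positive, so this is the 1-family
  have hwpos : 0 < UL 1 / UL 0 - σ := by linarith
  have hjp : 0 < UL 0 * (UL 1 / UL 0 - σ) := mul_pos hL hwpos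
  have hlt : UL 0 < UR 0 := by
    rcases entropicRankineHugoniot_compressive hγ h hL hR hne with ⟨-, hlt⟩ | ⟨hjn, -⟩
    · exact hlt
    · exact absurd hjp (not_lt.2 hjn.le)
  set s := UR 0 - UL 0 with hs
  have hs0 : 0 < s := sub_pos.2 hlt
  have hρR : UL 0 + s = UR 0 := by rw [hs]; ring
  have hP : 0 < (UR 0) ^ γ - (UL 0) ^ γ := sub_pos.2 (Real.rpow_lt_rpow hL.le hlt hγ0)
  -- `u_L - u_R > 0` and its square
  have hwR : UR 1 / UR 0 - σ = UL 0 * (UL 1 / UL 0 - σ) / UR 0 := by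
    rw [eq_div_iff hR.ne', hj]; ring
  have hdu : 0 < UL 1 / UL 0 - UR 1 / UR 0 := by
    have e : UL 1 / UL 0 - UR 1 / UR 0 = (UL 1 / UL 0 - σ) * (1 - UL 0 / UR 0) := by
      rw [show UL 1 / UL 0 - UR 1 / UR 0 = (UL 1 / UL 0 - σ) - (UR 1 / UR 0 - σ) by ring, hwR]
      field_simp
    rw [e]
    exact mul_pos hwpos (by rw [sub_pos, div_lt_one hR]; exact hlt)
  have hdu2 : (UL 1 / UL 0 - UR 1 / UR 0) ^ 2
      = ((UL 0 + s) ^ γ - (UL 0) ^ γ) * s / (UL 0 * (UL 0 + s)) := by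
    rw [hρR, eq_div_iff (by positivity), hs]
    linear_combination hS
  have hA : Real.sqrt (((UL 0 + s) ^ γ - (UL 0) ^ γ) * s / (UL 0 * (UL 0 + s)))
      = UL 1 / UL 0 - UR 1 / UR 0 := by
    rw [← hdu2, Real.sqrt_sq hdu.le]
  have hwL2 : (UL 1 / UL 0 - σ) ^ 2 = (UL 0 + s) / UL 0 * (((UL 0 + s) ^ γ - (UL 0) ^ γ) / s) := by
    have e1 : (σ - UL 1 / UL 0) ^ 2 = UR 0 * ((UR 0) ^ γ - (UL 0) ^ γ) / (UL 0 * s) :=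
      (eq_div_iff (by positivity)).2 hwL
    rw [show (UL 1 / UL 0 - σ) ^ 2 = (σ - UL 1 / UL 0) ^ 2 by ring, e1, hρR]
    field_simp
  have hB : Real.sqrt ((UL 0 + s) / UL 0 * (((UL 0 + s) ^ γ - (UL 0) ^ γ) / s))
      = UL 1 / UL 0 - σ := by
    rw [← hwL2, Real.sqrt_sq hwpos.le]
  refine ⟨hlt, ?_, ?_⟩
  · ext i
    fin_cases i
    · simp [hρR]
    · simp only [Fin.mk_one]
      rw [oneShockCurve_one_apply, hA, hρR]
      field_simp
      ring
  · unfold oneShockSpeed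
    rw [hB]
    ring

/-- **Chen–Krupa–Vasseur Assumption 1.1 (j) for isentropic Euler** (Leger–Vasseur (H'3)): an
entropic Rankine–Hugoniot discontinuity with `σ ≥ λ₂(u_R)` is a 2-shock: `u_L = S²_{u_R}(s)` and
`σ = σ²_{u_R}(s)` with `s = ρ_L - ρ_R > 0`. [cite: LegerVasseur2011, §6.1 and §2.2 (H'3)] -/
theorem entropicRankineHugoniot_mem_twoShockCurve (hγ : 1 < γ) {UL UR : Fin 2 → ℝ} {σ : ℝ}
    (h : IsEntropicRankineHugoniot (isentropicEulerFlux γ) (isentropicEulerEntropy γ)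
      (isentropicEulerEntropyFlux γ) UL UR σ)
    (hL : 0 < UL 0) (hR : 0 < UR 0) (hne : UL ≠ UR)
    (hσ : UR 1 / UR 0 + Real.sqrt γ * (UR 0) ^ ((γ - 1) / 2) ≤ σ) :
    UR 0 < UL 0 ∧ UL = twoShockCurve γ UR (UL 0 - UR 0) ∧
      σ = twoShockSpeed γ UR (UL 0 - UR 0) := by
  have hγ0 : 0 < γ := by linarith
  have hcR : 0 < Real.sqrt γ * (UR 0) ^ ((γ - 1) / 2) :=
    mul_pos (Real.sqrt_pos.2 hγ0) (Real.rpow_pos_of_pos hR _)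
  obtain ⟨hj, hS, -, hwR⟩ := rankineHugoniot_isentropicEuler_relations h.1 hL hR
  -- the mass flux is negative, so this is the 2-family
  have hwneg : UR 1 / UR 0 - σ < 0 := by linarith
  have hjn : UL 0 * (UL 1 / UL 0 - σ) < 0 := by rw [hj]; exact mul_neg_of_pos_of_neg hR hwneg
  have hgt : UR 0 < UL 0 := by
    rcases entropicRankineHugoniot_compressive hγ h hL hR hne with ⟨hjp, -⟩ | ⟨-, hgt⟩
    · exact absurd hjp (not_lt.2 hjn.le)
    · exact hgt
  set s := UL 0 - UR 0 with hs
  have hs0 : 0 < s := sub_pos.2 hgt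
  have hρL : UR 0 + s = UL 0 := by rw [hs]; ring
  have hP : 0 < (UL 0) ^ γ - (UR 0) ^ γ := sub_pos.2 (Real.rpow_lt_rpow hR.le hgt hγ0)
  have hwL : UL 1 / UL 0 - σ = UR 0 * (UR 1 / UR 0 - σ) / UL 0 := by
    rw [eq_div_iff hL.ne', ← hj]; ring
  have hdu : 0 < UL 1 / UL 0 - UR 1 / UR 0 := by
    have e : UL 1 / UL 0 - UR 1 / UR 0 = -(UR 1 / UR 0 - σ) * (1 - UR 0 / UL 0) := by
      rw [show UL 1 / UL 0 - UR 1 / UR 0 = (UL 1 / UL 0 - σ) - (UR 1 / UR 0 - σ) by ring, hwL]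
      field_simp
      ring
    rw [e]
    exact mul_pos (by linarith) (by rw [sub_pos, div_lt_one hL]; exact hgt)
  have hdu2 : (UL 1 / UL 0 - UR 1 / UR 0) ^ 2
      = ((UR 0 + s) ^ γ - (UR 0) ^ γ) * s / (UR 0 * (UR 0 + s)) := by
    rw [hρL, eq_div_iff (by positivity), hs]
    linear_combination hS
  have hA : Real.sqrt (((UR 0 + s) ^ γ - (UR 0) ^ γ) * s / (UR 0 * (UR 0 + s)))
      = UL 1 / UL 0 - UR 1 / UR 0 := by
    rw [← hdu2, Real.sqrt_sq hdu.le]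
  have hwR2 : (σ - UR 1 / UR 0) ^ 2 = (UR 0 + s) / UR 0 * (((UR 0 + s) ^ γ - (UR 0) ^ γ) / s) := by
    have hneg : UR 0 - UL 0 = -s := by rw [hs]; ring
    rw [hneg] at hwR
    have e0 : (σ - UR 1 / UR 0) ^ 2 * (UR 0 * s) = UL 0 * ((UL 0) ^ γ - (UR 0) ^ γ) := by
      linear_combination (-1 : ℝ) * hwR
    have e1 : (σ - UR 1 / UR 0) ^ 2 = UL 0 * ((UL 0) ^ γ - (UR 0) ^ γ) / (UR 0 * s) :=
      (eq_div_iff (by positivity)).2 e0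
    rw [e1, hρL]
    field_simp
  have hB : Real.sqrt ((UR 0 + s) / UR 0 * (((UR 0 + s) ^ γ - (UR 0) ^ γ) / s))
      = σ - UR 1 / UR 0 := by
    rw [← hwR2, Real.sqrt_sq (by linarith)]
  refine ⟨hgt, ?_, ?_⟩
  · ext i
    fin_cases i
    · simp [hρL]
    · simp only [Fin.mk_one]
      rw [twoShockCurve_one_apply, hA, hρL]
      field_simp
      ring
  · unfold twoShockSpeed
    rw [hB]
    ring

/-- **The 1-shock curve consists of entropic shocks** (Assumption 1.1 (f): "`(u_L, S¹_{u_L}(s),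
σ¹_{u_L}(s))` is the 1-shock with left hand state `u_L`"): for `s > 0` the discontinuity
`(U, S¹_U(s), σ¹_U(s))` satisfies the entropy inequality (`j = ρ √(…) > 0`, `G_ρ(ρ+s) < 0`).
[cite: LegerVasseur2011, §6.1 and §2.2 (H1)] -/
theorem isEntropicRankineHugoniot_oneShockCurve (hγ : 1 < γ) {U : Fin 2 → ℝ} (hρ : 0 < U 0)
    {s : ℝ} (hs : 0 < s) :
    IsEntropicRankineHugoniot (isentropicEulerFlux γ) (isentropicEulerEntropy γ)
      (isentropicEulerEntropyFlux γ) U (oneShockCurve γ U s) (oneShockSpeed γ U s) := by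
  have hγ0 : 0 < γ := by linarith
  have hRH := isRankineHugoniot_oneShockCurve hγ0 hρ hs
  refine ⟨hRH, ?_⟩
  have hρs : 0 < U 0 + s := by linarith
  have hR : 0 < oneShockCurve γ U s 0 := by simp; exact hρs
  have hne : U 0 ≠ oneShockCurve γ U s 0 := by simp; exact hs.ne'
  have hD := entropyDissipation_eq_massFlux_mul hγ hRH hρ hR hne
  have hG := (bernoulliJump_sign hγ hρ hR (c := U 0) (r := oneShockCurve γ U s 0)).1
    (by simp [hs])
  have hj : 0 < U 0 * (U 1 / U 0 - oneShockSpeed γ U s) := by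
    unfold oneShockSpeed
    have := Real.sqrt_pos.2 (speedRadicand_pos hγ0 hρ hs)
    nlinarith
  have : U 0 * (U 1 / U 0 - oneShockSpeed γ U s) *
      (γ / (γ - 1) * ((oneShockCurve γ U s 0) ^ (γ - 1) - (U 0) ^ (γ - 1))
        - ((oneShockCurve γ U s 0) ^ γ - (U 0) ^ γ) * (1 / oneShockCurve γ U s 0 + 1 / U 0) / 2)
      < 0 := mul_neg_of_pos_of_neg hj hG
  linarith

/-- **The 2-shock curve consists of entropic shocks** (Assumption 1.1 (f): "`(S²_{u_R}(s), u_R,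
σ²_{u_R}(s))` is the 2-shock with right hand state `u_R`"): for `s > 0` the discontinuity
`(S²_U(s), U, σ²_U(s))` satisfies the entropy inequality (`j < 0`, `G > 0`).
[cite: LegerVasseur2011, §6.1 and §2.2 (H'1)] -/
theorem isEntropicRankineHugoniot_twoShockCurve (hγ : 1 < γ) {U : Fin 2 → ℝ} (hρ : 0 < U 0)
    {s : ℝ} (hs : 0 < s) :
    IsEntropicRankineHugoniot (isentropicEulerFlux γ) (isentropicEulerEntropy γ)
      (isentropicEulerEntropyFlux γ) (twoShockCurve γ U s) U (twoShockSpeed γ U s) := by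
  have hγ0 : 0 < γ := by linarith
  have hRH := isRankineHugoniot_twoShockCurve hγ0 hρ hs
  refine ⟨hRH, ?_⟩
  have hρs : 0 < U 0 + s := by linarith
  have hL : 0 < twoShockCurve γ U s 0 := by simp; exact hρs
  have hne : twoShockCurve γ U s 0 ≠ U 0 := by simp; exact hs.ne'
  have hD := entropyDissipation_eq_massFlux_mul hγ hRH hL hρ hne
  have hG := (bernoulliJump_sign hγ hL hρ (c := twoShockCurve γ U s 0) (r := U 0)).2
    (by simp [hs])
  have hAB := mul_sqrt_speedRadicand_eq hγ0 hρ hs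
  have hvel : twoShockCurve γ U s 1 / twoShockCurve γ U s 0
      = U 1 / U 0 + Real.sqrt (((U 0 + s) ^ γ - (U 0) ^ γ) * s / (U 0 * (U 0 + s))) := by
    rw [twoShockCurve_one_apply, twoShockCurve_zero_apply, mul_div_cancel_left₀ _ hρs.ne']
  have hj : twoShockCurve γ U s 0 * (twoShockCurve γ U s 1 / twoShockCurve γ U s 0
      - twoShockSpeed γ U s) < 0 := by
    rw [hvel, twoShockCurve_zero_apply]
    unfold twoShockSpeed
    have hA0 := Real.sqrt_pos.2 (velJumpRadicand_pos hγ0 hρ hs)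
    -- `(ρ+s)(A - B) = (ρ+s)A - (ρ+s)B = sB - (ρ+s)B = -ρB < 0`
    have hB0 := Real.sqrt_pos.2 (speedRadicand_pos hγ0 hρ hs)
    nlinarith
  have : twoShockCurve γ U s 0 * (twoShockCurve γ U s 1 / twoShockCurve γ U s 0
      - twoShockSpeed γ U s) *
      (γ / (γ - 1) * ((U 0) ^ (γ - 1) - (twoShockCurve γ U s 0) ^ (γ - 1))
        - ((U 0) ^ γ - (twoShockCurve γ U s 0) ^ γ) * (1 / U 0 + 1 / twoShockCurve γ U s 0) / 2)
      < 0 := mul_neg_of_neg_of_pos hj hG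
  linarith

/-! ### The shock speeds start at the characteristic speeds: `σ^{1,2}_U(0+) = λ_{1,2}(U)` -/

/-- The radicand of the shock speeds tends to `P′(ρ) = γρ^{γ-1}` as `s → 0+`. [folklore] -/
theorem tendsto_speedRadicand (γ : ℝ) {ρ : ℝ} (hρ : 0 < ρ) :
    Filter.Tendsto (fun s : ℝ => (ρ + s) / ρ * (((ρ + s) ^ γ - ρ ^ γ) / s)) (nhdsWithin 0 (Ioi 0))
      (nhds (γ * ρ ^ (γ - 1))) := by
  have hd : HasDerivAt (fun r : ℝ => r ^ γ) (γ * ρ ^ (γ - 1)) ρ :=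
    Real.hasDerivAt_rpow_const (p := γ) (Or.inl hρ.ne')
  have hslope := hd.tendsto_slope_zero_right
  simp only [smul_eq_mul] at hslope
  have h1 : Filter.Tendsto (fun s : ℝ => (ρ + s) / ρ) (nhdsWithin 0 (Ioi 0)) (nhds 1) := by
    have : Filter.Tendsto (fun s : ℝ => (ρ + s) / ρ) (nhds 0) (nhds ((ρ + 0) / ρ)) :=
      ((continuous_const.add continuous_id).div_const ρ).tendsto 0
    rw [add_zero, div_self hρ.ne'] at this
    exact this.mono_left nhdsWithin_le_nhds
  have h2 : Filter.Tendsto (fun s : ℝ => ((ρ + s) ^ γ - ρ ^ γ) / s) (nhdsWithin 0 (Ioi 0))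
      (nhds (γ * ρ ^ (γ - 1))) := by
    refine hslope.congr' ?_
    filter_upwards [self_mem_nhdsWithin] with s hs
    rw [div_eq_inv_mul]
  simpa using h1.mul h2

/-- **`σ¹_U(0+) = λ₁(U)`** (Leger–Vasseur (H1a): "`σ_U(0) = λ⁻(U)`"): the 1-shock speed tends to
`u - √γ ρ^{(γ-1)/2}` as the density jump `s → 0+` (`ρ > 0`, `γ ≥ 0`).
[cite: LegerVasseur2011, §2.2 (H1a), §6.1] -/
theorem tendsto_oneShockSpeed (hγ : 0 ≤ γ) {U : Fin 2 → ℝ} (hρ : 0 < U 0) :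
    Filter.Tendsto (oneShockSpeed γ U) (nhdsWithin 0 (Ioi 0))
      (nhds (U 1 / U 0 - Real.sqrt γ * (U 0) ^ ((γ - 1) / 2))) := by
  have h := (tendsto_speedRadicand γ hρ).sqrt
  rw [← sq_soundSpeed hγ hρ, Real.sqrt_sq (by positivity)] at h
  exact tendsto_const_nhds.sub h

/-- **`σ²_U(0+) = λ₂(U)`** (Leger–Vasseur (H'1a): "`σ_U(0) = λ⁺(U)`"): the 2-shock speed tends to
`u + √γ ρ^{(γ-1)/2}` as the density jump `s → 0+`. [cite: LegerVasseur2011, §2.2 (H'1a), §6.1] -/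
theorem tendsto_twoShockSpeed (hγ : 0 ≤ γ) {U : Fin 2 → ℝ} (hρ : 0 < U 0) :
    Filter.Tendsto (twoShockSpeed γ U) (nhdsWithin 0 (Ioi 0))
      (nhds (U 1 / U 0 + Real.sqrt γ * (U 0) ^ ((γ - 1) / 2))) := by
  have h := (tendsto_speedRadicand γ hρ).sqrt
  rw [← sq_soundSpeed hγ hρ, Real.sqrt_sq (by positivity)] at h
  exact tendsto_const_nhds.add h

end Literature.Analysis.PDE
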